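import Summits.ResolutionOfSingularities.ResolutionOfSingularities.Theorems.FrobeniusLadderFInjectiveMacaulayficationPencilFedder
import Summits.ResolutionOfSingularities.ResolutionOfSingularities.Theorems.FrobeniusLadderFInjectiveMacaulayficationGermOfGlobalBlowup
import Summits.ResolutionOfSingularities.ResolutionOfSingularities.Theorems.FrobeniusLadderFInjectiveMacaulayficationDoublePointFermatCubicGerm
import Summits.ResolutionOfSingularities.ResolutionOfSingularities.Theorems.FrobeniusLadderFInjectiveMacaulayficationPencilIntegral
import HarnessLib

/-!
# Ω₁ KERNEL ROW — THE INPUT COLUMN on the local model: the pencil floor `𝒥 = (c²², a² − b³)` of `R = k[a,b,c,d]` is NOT FULL at EVERY point of `ℙ¹_Q`, for EVERY prime `p`,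
# and both pencil charts are CM hypersurfaces; plus the regular-sequence certificate `a² − b³` regular modulo `c²²` (the integrality input)
# (crux `FInjectiveMacaulayfication` stmt-ResolutionOfSingularities-15315, chain w45a; res-L1-w45a-plan-1 RULING R23.2 (3) «stub-3 g12 — NEXT (α) = THE INPUT COLUMN OF THE Ω₁ ROW:
# LEGAL ∧ NOT FULL along the whole ℙ¹_Q (`pencilChart_not_full_at (w₀)` + `_infty`, deep memberships by `pencil_pow_mem`) … say which p the (†) criterion gives»; seat
# res-L1-w45a-stub-3 g12; engine = res-L1-w45a-stub-1 g14ʼs ✓ p689316 `PencilFedder`; data side = ✓ p694236 `OmegaOneCureFanCert`)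

[OURS · L1 W4.5a] Support file (`--supports stmt-ResolutionOfSingularities-15315 --as helper`); def-free; UNCONDITIONAL; no named fact; NOT a statement of any manuscript; nothing of the
crux is proved (the local-model input column of a next-generation row). AI-written (AI review is weaker than expert review).

SETTING (res-L1-w45a-idea-1 Q17 / res-L1-w45a-tri-2 g20, BED Ω on B9). Étale-locally along `Γ₉` the class model is `R = k[a,b,c,d]` (`a,b,c,d = X 0, X 1, X 2, X 3`), boundary
`E = {c = 0}`, and the admissible floor `Ω₁` has marked ideal `𝒥 = (M, B)`, `M = c²²`, `B = a² − b³`; `S′ = Bl_𝒥 R` has the pencil charts `{M·(W + w₀) = B}` (pencil variable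
`W = X 4`, every `w₀ ∈ k`) and `{B·U = M}` over `Q = 0`, with fibre `ℙ¹_Q`.
* §1 ★ `deep_mem` — THE DEEP MEMBERSHIPS, p-UNIFORM: `M^j·B^{p−1−j} ∈ (a^p, b^p, c^p, d^p)` for ALL `j ≤ p − 1` and EVERY `p ≥ 2` (binomial expansion of `(a² − b³)^{p−1−j}`: the term
  `c^{22j} a^{2m} b^{3(p−1−j−m)}` has `22j ≥ p`, or `2m ≥ p`, or else `3(p−1−j−m) ≥ p` — linear arithmetic). So the (†) criterion of res-L1-w45a-tri-2 g20 FAILS at `Q` for every prime: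
  the answer to the deskʼs «which p» is ALL `p` (no `p ∤ 18` proviso is needed for the NOT-FULL half).
* §2 ★★ `pencilChart_not_full_at` / `pencilChart_not_full_infty` — for every prime `p = char k`: the point `(Q, w₀)` of the `W`-chart and the point `W = ∞` of the `U`-chart are NOT
  `FullCl p` — i.e. `S′_{Ω₁}` is NOT FULL at EVERY `k`-point of `ℙ¹_Q` (one application each of ✓ `PencilFedder.pencilChart_not_full_at` / `_infty` on §1).
* §3 `wChart_ne_zero`, `uChart_ne_zero`, `cmCl_stalk_wChart`, `cmCl_stalk_uChart` — both charts are hypersurfaces in `𝔸⁵`, hence satisfy the CM clause at every stalk (tree: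
  `DoublePointFermatCubicGerm.cmCl_localization_hypersurface` + `GermOfGlobalBlowup.cmCl_stalk_Spec_of_cmCl_localization`).
* §4 `B_ne_zero`, `not_X_dvd_B`, ★ `hreg_W` — `a² − b³` is REGULAR modulo `c²²` (`B·t ∈ (c²²) ⇒ t ∈ (c²²)`, from `Prime c` and `c ∤ B`): the hypothesis `hreg` of res-L1-w45a-stub-1ʼs
  ✓ `PencilIntegral.isPrime_span_C_mul_X_sub_C` / `pencilChart_isPrime` (integrality of the `W`-chart). NOT done here (said plainly): the primality of the two chart polynomials in
  `MvPolynomial (Fin 5) k` letter (stub-1ʼs `pencilChart_isPrime` is stated over a class-model chart `k[Y]/(G)`; the `G`-free transport `Polynomial (k[a,b,c,d]) ≅ k[a,b,c,d,W]` is one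
  plumbing lemma away), and regularity of `S′` off the closed fibre; the CURE column is TASK 4b/4c (✓ p694236 data + stub-1ʼs soundness lemma).
* §5 (APPENDED) `affinePencilChart_isPrime` / `affinePencilChart_isPrime_last` — the G-FREE transport of ✓ `PencilIntegral.isPrime_span_C_mul_X_sub_C` to `k[Y₀..Y_n]` (both
  conventions), and ★ `isPrime_wChart (w₀)` — EVERY `W`-chart `(c²²·(W + w₀) − (a² − b³))` of `Ω₁`ʼs local model is PRIME (integral).
* §6 (APPENDED) `prime_B` — the cusp `a² − b³` is PRIME in `k[a,b,c,d]`; `hreg_U` — `c²²` is regular modulo it; ★ `isPrime_uChart` — the `U`-chart `((a² − b³)·U − c²²)` is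
  PRIME: EVERY chart of `S′_{Ω₁}` (local model) is integral.
[cite: Fedder1983, Prop. 1.7 and Thm. 1.12] [folklore]
-/

-- single-problem summit: the doubled namespace component is forced
set_option linter.dupNamespace false

noncomputable section

open CategoryTheory AlgebraicGeometry TopologicalSpace IsLocalRing MvPolynomial
open Literature.AlgebraicGeometry.Resolution

namespace Summit.ResolutionOfSingularities.ResolutionOfSingularities.Theorems.FInjectiveMacaulayfication.OmegaOneFloorInput

open Summit.ResolutionOfSingularities.ResolutionOfSingularities.Theorems.FInjectiveMacaulayfication
open SliceableCentre

/-! ## §1 ★ The deep memberships, for every `p ≥ 2` -/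

/-- ★ **`(c²²)^j · (a² − b³)^{p−1−j} ∈ (a^p, b^p, c^p, d^p)` for all `j ≤ p − 1`, every `p ≥ 2`.** [OURS · p-uniform certificate; cite: Fedder1983, Prop. 1.7 (context)] -/
theorem deep_mem (k : Type) [Field k] (p : ℕ) (hp : 2 ≤ p) (j : ℕ) (_hj : j ≤ p - 1) :
    ((X 2 : MvPolynomial (Fin 4) k) ^ 22) ^ j * (X 0 ^ 2 - X 1 ^ 3) ^ (p - 1 - j) ∈
      Ideal.span (Set.range fun i : Fin 4 => (X i : MvPolynomial (Fin 4) k) ^ p) := by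
  set I : Ideal (MvPolynomial (Fin 4) k) := Ideal.span (Set.range fun i : Fin 4 => (X i : MvPolynomial (Fin 4) k) ^ p) with hI
  have ha : (X 0 : MvPolynomial (Fin 4) k) ^ p ∈ I := Ideal.subset_span ⟨0, rfl⟩
  have hb : (X 1 : MvPolynomial (Fin 4) k) ^ p ∈ I := Ideal.subset_span ⟨1, rfl⟩
  have hc : (X 2 : MvPolynomial (Fin 4) k) ^ p ∈ I := Ideal.subset_span ⟨2, rfl⟩
  by_cases hcj : p ≤ 22 * j
  · -- the `c`-degree is at least `p`
    have e1 : (((X 2 : MvPolynomial (Fin 4) k) ^ 22) ^ j) = X 2 ^ p * X 2 ^ (22 * j - p) := by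
      rw [← pow_mul, ← pow_add]; congr 1; omega
    rw [e1, mul_assoc]
    exact Ideal.mul_mem_right _ _ hc
  · rw [sub_eq_add_neg, add_pow, Finset.mul_sum]
    refine Ideal.sum_mem _ fun m hm => ?_
    rw [Finset.mem_range] at hm
    by_cases h2m : p ≤ 2 * m
    · -- the `a`-degree is at least `p`
      have e2 : (((X 0 : MvPolynomial (Fin 4) k) ^ 2) ^ m) = X 0 ^ p * X 0 ^ (2 * m - p) := by
        rw [← pow_mul, ← pow_add]; congr 1; omega
      rw [e2]
      exact Ideal.mul_mem_left _ _ (Ideal.mul_mem_right _ _ (Ideal.mul_mem_right _ _ (Ideal.mul_mem_right _ _ ha)))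
    · -- the `b`-degree is at least `p`
      have h3 : p ≤ 3 * (p - 1 - j - m) := by omega
      have e3 : (-((X 1 : MvPolynomial (Fin 4) k) ^ 3)) ^ (p - 1 - j - m) = (-1) ^ (p - 1 - j - m) * (X 1 ^ p * X 1 ^ (3 * (p - 1 - j - m) - p)) := by
        rw [neg_pow, ← pow_mul, ← pow_add]; congr 2; omega
      rw [e3]
      exact Ideal.mul_mem_left _ _ (Ideal.mul_mem_right _ _ (Ideal.mul_mem_left _ _ (Ideal.mul_mem_left _ _ (Ideal.mul_mem_right _ _ hb))))

/-- `M = c²² ≠ 0`. [plumbing] -/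
theorem M_ne_zero (k : Type) [Field k] : ((X 2 : MvPolynomial (Fin 4) k) ^ 22) ≠ 0 := pow_ne_zero _ (X_ne_zero _)

/-- `M(0) = 0`. [plumbing] -/
theorem constantCoeff_M (k : Type) [Field k] : constantCoeff (((X 2 : MvPolynomial (Fin 4) k) ^ 22)) = 0 := by
  rw [map_pow, constantCoeff_X, zero_pow (by norm_num)]

/-- `B(0) = 0`. [plumbing] -/
theorem constantCoeff_B (k : Type) [Field k] : constantCoeff ((X 0 ^ 2 - X 1 ^ 3 : MvPolynomial (Fin 4) k)) = 0 := by
  rw [map_sub, map_pow, map_pow, constantCoeff_X, constantCoeff_X]; norm_num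

/-! ## §2 ★★ NOT FULL at every `k`-point of `ℙ¹_Q`, for every prime `p` -/

/-- ★★ **THE `W`-CHART POINTS**: for every prime `p = char k` and every `w₀ ∈ k`, the origin of `V(c²²·(W + w₀) − (a² − b³)) ⊂ 𝔸⁵` — the point `(Q, w₀)` of the fibre `ℙ¹_Q` of
`S′_{Ω₁} → R` — is NOT `FullCl p`. [OURS · certificate instance; cite: Fedder1983, Thm. 1.12] -/
theorem pencilChart_not_full_at (k : Type) [Field k] (p : ℕ) [Fact p.Prime] [CharP k p] (w₀ : k) (G : MvPolynomial (Fin 5) k)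
    (hG : G = rename (Fin.castSucc : Fin 4 → Fin 5) ((X 2 : MvPolynomial (Fin 4) k) ^ 22) * (X (Fin.last 4) + C w₀) -
      rename (Fin.castSucc : Fin 4 → Fin 5) (X 0 ^ 2 - X 1 ^ 3 : MvPolynomial (Fin 4) k))
    (v : Spec (.of (MvPolynomial (Fin 5) k ⧸ Ideal.span {G})))
    (hv : v.asIdeal = Ideal.span (Set.range fun j : Fin 5 => Ideal.Quotient.mk (Ideal.span {G}) (X j))) :
    ¬ FullCl p ((Spec (.of (MvPolynomial (Fin 5) k ⧸ Ideal.span {G}))).presheaf.stalk v) :=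
  PencilFedder.pencilChart_not_full_at k p _ _ (M_ne_zero k) (constantCoeff_M k) (constantCoeff_B k)
    (fun j hj => deep_mem k p (Fact.out : p.Prime).two_le j hj) w₀ G hG v hv

/-- ★★ **THE POINT `W = ∞`**: for every prime `p = char k`, the origin of `V((a² − b³)·U − c²²) ⊂ 𝔸⁵` is NOT `FullCl p`. With `pencilChart_not_full_at`: `S′_{Ω₁}` is NOT FULL at EVERY
`k`-point of `ℙ¹_Q`, for every prime. [OURS · certificate instance; cite: Fedder1983, Thm. 1.12] -/
theorem pencilChart_not_full_infty (k : Type) [Field k] (p : ℕ) [Fact p.Prime] [CharP k p] (G : MvPolynomial (Fin 5) k)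
    (hG : G = rename (Fin.castSucc : Fin 4 → Fin 5) (X 0 ^ 2 - X 1 ^ 3 : MvPolynomial (Fin 4) k) * X (Fin.last 4) -
      rename (Fin.castSucc : Fin 4 → Fin 5) ((X 2 : MvPolynomial (Fin 4) k) ^ 22))
    (v : Spec (.of (MvPolynomial (Fin 5) k ⧸ Ideal.span {G})))
    (hv : v.asIdeal = Ideal.span (Set.range fun j : Fin 5 => Ideal.Quotient.mk (Ideal.span {G}) (X j))) :
    ¬ FullCl p ((Spec (.of (MvPolynomial (Fin 5) k ⧸ Ideal.span {G}))).presheaf.stalk v) :=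
  PencilFedder.pencilChart_not_full_infty k p _ _ (M_ne_zero k) (constantCoeff_M k)
    (fun j hj => deep_mem k p (Fact.out : p.Prime).two_le j hj) G hG v hv

/-! ## §3 The CM clause: both charts are hypersurfaces -/

/-- The renamed base polynomials, spelled out in `k[X₀..X₄]`. [plumbing] -/
theorem rename_M (k : Type) [Field k] : rename (Fin.castSucc : Fin 4 → Fin 5) ((X 2 : MvPolynomial (Fin 4) k) ^ 22) = X 2 ^ 22 := by
  rw [map_pow, rename_X]; rfl

/-- See `rename_M`. [plumbing] -/
theorem rename_B (k : Type) [Field k] : rename (Fin.castSucc : Fin 4 → Fin 5) (X 0 ^ 2 - X 1 ^ 3 : MvPolynomial (Fin 4) k) = X 0 ^ 2 - X 1 ^ 3 := by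
  rw [map_sub, map_pow, map_pow, rename_X, rename_X]; rfl

/-- The `W`-chart polynomial is non-zero (it takes the value `1` at `(0, 1, 0, 0, 0)`; note `b³ ↦ 1`, any characteristic). [plumbing] -/
theorem wChart_ne_zero (k : Type) [Field k] (w₀ : k) (G : MvPolynomial (Fin 5) k)
    (hG : G = rename (Fin.castSucc : Fin 4 → Fin 5) ((X 2 : MvPolynomial (Fin 4) k) ^ 22) * (X (Fin.last 4) + C w₀) -
      rename (Fin.castSucc : Fin 4 → Fin 5) (X 0 ^ 2 - X 1 ^ 3 : MvPolynomial (Fin 4) k)) : G ≠ 0 := by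
  intro h0
  have h := congrArg (aeval (![0, 1, 0, 0, 0] : Fin 5 → k)) h0
  rw [hG, rename_M, rename_B, map_zero] at h
  simp only [map_sub, map_mul, map_add, map_pow, aeval_X, aeval_C, Matrix.cons_val_zero, Matrix.cons_val_one, Algebra.algebraMap_self, RingHom.id_apply] at h
  have h2 : (![0, 1, 0, 0, 0] : Fin 5 → k) 2 = 0 := rfl
  rw [h2] at h
  norm_num at h

/-- The `U`-chart polynomial is non-zero (value `1` at `(1, 0, 0, 0, 1)`). [plumbing] -/
theorem uChart_ne_zero (k : Type) [Field k] (G : MvPolynomial (Fin 5) k)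
    (hG : G = rename (Fin.castSucc : Fin 4 → Fin 5) (X 0 ^ 2 - X 1 ^ 3 : MvPolynomial (Fin 4) k) * X (Fin.last 4) -
      rename (Fin.castSucc : Fin 4 → Fin 5) ((X 2 : MvPolynomial (Fin 4) k) ^ 22)) : G ≠ 0 := by
  intro h0
  have h := congrArg (aeval (![1, 0, 0, 0, 1] : Fin 5 → k)) h0
  rw [hG, rename_M, rename_B, map_zero] at h
  simp only [map_sub, map_mul, map_pow, aeval_X, Matrix.cons_val_zero, Matrix.cons_val_one] at h
  have h2 : (![1, 0, 0, 0, 1] : Fin 5 → k) 2 = 0 := rfl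
  have h4 : (![1, 0, 0, 0, 1] : Fin 5 → k) (Fin.last 4) = 1 := rfl
  rw [h2, h4] at h
  norm_num at h

/-- The `W`-chart satisfies the CM clause at every stalk (a hypersurface in `𝔸⁵`). [tree assembly] -/
theorem cmCl_stalk_wChart (k : Type) [Field k] (w₀ : k) (G : MvPolynomial (Fin 5) k)
    (hG : G = rename (Fin.castSucc : Fin 4 → Fin 5) ((X 2 : MvPolynomial (Fin 4) k) ^ 22) * (X (Fin.last 4) + C w₀) -
      rename (Fin.castSucc : Fin 4 → Fin 5) (X 0 ^ 2 - X 1 ^ 3 : MvPolynomial (Fin 4) k))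
    (y : Spec (.of (MvPolynomial (Fin 5) k ⧸ Ideal.span {G}))) :
    CMCl ((Spec (.of (MvPolynomial (Fin 5) k ⧸ Ideal.span {G}))).presheaf.stalk y) :=
  GermOfGlobalBlowup.cmCl_stalk_Spec_of_cmCl_localization y (DoublePointFermatCubicGerm.cmCl_localization_hypersurface k G (wChart_ne_zero k w₀ G hG) y)

/-- The `U`-chart satisfies the CM clause at every stalk. [tree assembly] -/
theorem cmCl_stalk_uChart (k : Type) [Field k] (G : MvPolynomial (Fin 5) k)
    (hG : G = rename (Fin.castSucc : Fin 4 → Fin 5) (X 0 ^ 2 - X 1 ^ 3 : MvPolynomial (Fin 4) k) * X (Fin.last 4) -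
      rename (Fin.castSucc : Fin 4 → Fin 5) ((X 2 : MvPolynomial (Fin 4) k) ^ 22))
    (y : Spec (.of (MvPolynomial (Fin 5) k ⧸ Ideal.span {G}))) :
    CMCl ((Spec (.of (MvPolynomial (Fin 5) k ⧸ Ideal.span {G}))).presheaf.stalk y) :=
  GermOfGlobalBlowup.cmCl_stalk_Spec_of_cmCl_localization y (DoublePointFermatCubicGerm.cmCl_localization_hypersurface k G (uChart_ne_zero k G hG) y)

/-! ## §4 The integrality input: `a² − b³` is regular modulo `c²²` -/

/-- `B = a² − b³ ≠ 0` (value `1` at `(1, 0, 0, 0)`). [plumbing] -/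
theorem B_ne_zero (k : Type) [Field k] : (X 0 ^ 2 - X 1 ^ 3 : MvPolynomial (Fin 4) k) ≠ 0 := by
  intro h0
  have h := congrArg (aeval (![1, 0, 0, 0] : Fin 4 → k)) h0
  simp only [map_sub, map_pow, aeval_X, Matrix.cons_val_zero, Matrix.cons_val_one, map_zero] at h
  norm_num at h

/-- `c ∤ a² − b³` (kill `c`: the substitution `c ↦ 0` fixes `B ≠ 0` but annihilates every multiple of `c`). [elementary] -/
theorem not_X_dvd_B (k : Type) [Field k] : ¬ (X 2 : MvPolynomial (Fin 4) k) ∣ (X 0 ^ 2 - X 1 ^ 3) := by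
  rintro ⟨q, hq⟩
  have h := congrArg (aeval (fun i : Fin 4 => if i = 2 then (0 : MvPolynomial (Fin 4) k) else X i)) hq
  rw [map_mul, aeval_X, if_pos rfl, zero_mul, map_sub, map_pow, map_pow, aeval_X, aeval_X,
    if_neg (by decide : (0 : Fin 4) ≠ 2), if_neg (by decide : (1 : Fin 4) ≠ 2)] at h
  exact B_ne_zero k h

/-- ★ **`a² − b³` IS REGULAR MODULO `c²²`**: `B·t ∈ (c²²) ⇒ t ∈ (c²²)` — the hypothesis `hreg` of ✓ `PencilIntegral.isPrime_span_C_mul_X_sub_C` for the `W`-chart of `Ω₁`ʼs local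
model (`c` is prime and does not divide `B`). [elementary; cite: Matsumura1987, Thm. 17.4 (context: regular sequences)] -/
theorem hreg_W (k : Type) [Field k] (t : MvPolynomial (Fin 4) k)
    (ht : (X 0 ^ 2 - X 1 ^ 3 : MvPolynomial (Fin 4) k) * t ∈ Ideal.span {((X 2 : MvPolynomial (Fin 4) k) ^ 22)}) :
    t ∈ Ideal.span {((X 2 : MvPolynomial (Fin 4) k) ^ 22)} := by
  rw [Ideal.mem_span_singleton] at ht ⊢
  exact (MvPolynomial.X_prime (i := (2 : Fin 4))).pow_dvd_of_dvd_mul_left 22 (not_X_dvd_B k) ht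

/-! ## §5 Integrality of the affine `W`-charts (G-free transport of ✓ `PencilIntegral.isPrime_span_C_mul_X_sub_C`) -/

/-- **G-FREE PENCIL-CHART PRIMALITY** (`Fin.succ` convention): for `M ≠ 0` and `B` regular modulo `M` in `k[Y₀..Y_{n−1}]`, `(M⁺·Y₀ − B⁺)` is prime in `k[Y₀..Y_n]`
(`q⁺ = rename Fin.succ q`) — ✓ `PencilIntegral.isPrime_span_C_mul_X_sub_C` transported along `MvPolynomial.finSuccEquiv` (res-L1-w45a-stub-1ʼs `pencilChart_isPrime` without the
class-model equation `G`: the local model `R = k[a,b,c,d]` is affine space). [folklore] -/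
theorem affinePencilChart_isPrime (k : Type) [Field k] {n : ℕ} (M B : MvPolynomial (Fin n) k) (hM : M ≠ 0)
    (hreg : ∀ t : MvPolynomial (Fin n) k, B * t ∈ Ideal.span {M} → t ∈ Ideal.span {M}) :
    (Ideal.span {rename Fin.succ M * X 0 - rename Fin.succ B} : Ideal (MvPolynomial (Fin (n + 1)) k)).IsPrime := by
  classical
  haveI hprime := PencilIntegral.isPrime_span_C_mul_X_sub_C M B hM hreg
  set e : MvPolynomial (Fin (n + 1)) k →+* Polynomial (MvPolynomial (Fin n) k) :=
    (MvPolynomial.finSuccEquiv k n : MvPolynomial (Fin (n + 1)) k →+* Polynomial (MvPolynomial (Fin n) k)) with he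
  have hsurj : Function.Surjective e := (MvPolynomial.finSuccEquiv k n).surjective
  have hinj : Function.Injective e := (MvPolynomial.finSuccEquiv k n).injective
  have hL : e (rename Fin.succ M * X 0 - rename Fin.succ B) = Polynomial.C M * Polynomial.X - Polynomial.C B := by
    rw [map_sub, map_mul, he, RingHom.coe_coe, PencilIntegral.finSuccEquiv_rename_succ k M, PencilIntegral.finSuccEquiv_rename_succ k B,
      MvPolynomial.finSuccEquiv_X_zero]
  have hcomap : (Ideal.span {Polynomial.C M * Polynomial.X - Polynomial.C B}).comap e =
      (Ideal.span {rename Fin.succ M * X 0 - rename Fin.succ B} : Ideal (MvPolynomial (Fin (n + 1)) k)) := by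
    rw [← hL, ← Set.image_singleton, ← Ideal.map_span, Ideal.comap_map_of_surjective e hsurj, ← RingHom.ker_eq_comap_bot,
      (RingHom.injective_iff_ker_eq_bot e).1 hinj, sup_bot_eq]
  rw [← hcomap]
  exact Ideal.comap_isPrime e _

/-- Renaming along `finRotate (n+1)` carries `q(Y_{castSucc ·})` to `q(Y_{succ ·})` (local copy of res-L1-w45a-stub-1ʼs bridge lemma). [plumbing] -/
theorem rename_finRotate_castSucc' (k : Type) [Field k] {n : ℕ} (q : MvPolynomial (Fin n) k) :
    rename (finRotate (n + 1)) (rename Fin.castSucc q) = rename Fin.succ q := by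
  rw [rename_rename]
  have h : (⇑(finRotate (n + 1)) ∘ Fin.castSucc : Fin n → Fin (n + 1)) = Fin.succ := by
    funext j
    show finRotate (n + 1) (Fin.castSucc j) = j.succ
    ext
    rw [coe_finRotate_of_ne_last (Fin.castSucc_lt_last j).ne, Fin.val_castSucc, Fin.val_succ]
  rw [h]

/-- **The same in the `Fin.castSucc`/`Fin.last` convention** of ✓ `PencilFedder.pencilChart_not_full_at` (pencil variable `Y_n`). [folklore] -/
theorem affinePencilChart_isPrime_last (k : Type) [Field k] {n : ℕ} (M B : MvPolynomial (Fin n) k) (hM : M ≠ 0)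
    (hreg : ∀ t : MvPolynomial (Fin n) k, B * t ∈ Ideal.span {M} → t ∈ Ideal.span {M}) :
    (Ideal.span {rename Fin.castSucc M * X (Fin.last n) - rename Fin.castSucc B} : Ideal (MvPolynomial (Fin (n + 1)) k)).IsPrime := by
  haveI := affinePencilChart_isPrime k M B hM hreg
  set ρ : MvPolynomial (Fin (n + 1)) k →+* MvPolynomial (Fin (n + 1)) k :=
    (MvPolynomial.renameEquiv k (finRotate (n + 1)) : MvPolynomial (Fin (n + 1)) k →+* MvPolynomial (Fin (n + 1)) k) with hρ
  have hρq : ∀ q : MvPolynomial (Fin n) k, ρ (rename Fin.castSucc q) = rename Fin.succ q := fun q => by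
    rw [hρ, RingHom.coe_coe, MvPolynomial.renameEquiv_apply, rename_finRotate_castSucc']
  have hρX : ρ (X (Fin.last n)) = X 0 := by
    rw [hρ, RingHom.coe_coe, MvPolynomial.renameEquiv_apply, rename_X, finRotate_last]
  have hsurj : Function.Surjective ρ := (MvPolynomial.renameEquiv k (finRotate (n + 1))).surjective
  have hinj : Function.Injective ρ := (MvPolynomial.renameEquiv k (finRotate (n + 1))).injective
  have hmap : Ideal.map ρ (Ideal.span {rename Fin.castSucc M * X (Fin.last n) - rename Fin.castSucc B}) =
      Ideal.span {rename Fin.succ M * X 0 - rename Fin.succ B} := by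
    rw [Ideal.map_span, Set.image_singleton, map_sub, map_mul, hρq, hρq, hρX]
  have hcomap : (Ideal.span {rename Fin.castSucc M * X (Fin.last n) - rename Fin.castSucc B} : Ideal (MvPolynomial (Fin (n + 1)) k)) =
      (Ideal.span {rename Fin.succ M * X 0 - rename Fin.succ B}).comap ρ := by
    rw [← hmap, Ideal.comap_map_of_surjective ρ hsurj, ← RingHom.ker_eq_comap_bot, (RingHom.injective_iff_ker_eq_bot ρ).1 hinj, sup_bot_eq]
  rw [hcomap]
  exact Ideal.comap_isPrime ρ _

/-- ★ **THE `W`-CHARTS OF `Ω₁`ʼS LOCAL MODEL ARE INTEGRAL**: for every `w₀ ∈ k`, `(c²²·(W + w₀) − (a² − b³))` is a PRIME ideal of `k[a,b,c,d,W]` (`a² − b³ − w₀c²²` is regular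
modulo `c²²` by `hreg_W`). The `U`-chart `{(a² − b³)·U = c²²}` (integral iff `c²²` is regular modulo the prime `a² − b³`) is NOT treated here. [OURS · certificate instance] -/
theorem isPrime_wChart (k : Type) [Field k] (w₀ : k) (G : MvPolynomial (Fin 5) k)
    (hG : G = rename (Fin.castSucc : Fin 4 → Fin 5) ((X 2 : MvPolynomial (Fin 4) k) ^ 22) * (X (Fin.last 4) + C w₀) -
      rename (Fin.castSucc : Fin 4 → Fin 5) (X 0 ^ 2 - X 1 ^ 3 : MvPolynomial (Fin 4) k)) :
    (Ideal.span {G}).IsPrime := by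
  have key : G = rename (Fin.castSucc : Fin 4 → Fin 5) ((X 2 : MvPolynomial (Fin 4) k) ^ 22) * X (Fin.last 4) -
      rename (Fin.castSucc : Fin 4 → Fin 5) (X 0 ^ 2 - X 1 ^ 3 - C w₀ * X 2 ^ 22 : MvPolynomial (Fin 4) k) := by
    rw [hG]
    simp only [map_sub, map_mul, map_pow, rename_X, rename_C]
    ring
  rw [key]
  refine affinePencilChart_isPrime_last k _ _ (M_ne_zero k) (fun t ht => hreg_W k t ?_)
  have hsplit : (X 0 ^ 2 - X 1 ^ 3 : MvPolynomial (Fin 4) k) * t = (X 0 ^ 2 - X 1 ^ 3 - C w₀ * X 2 ^ 22) * t + C w₀ * t * X 2 ^ 22 := by ring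
  rw [hsplit]
  exact Ideal.add_mem _ ht (Ideal.mul_mem_left _ _ (Ideal.mem_span_singleton_self _))

/-! ## §6 Integrality of the `U`-chart: `a² − b³` is prime, `c²²` is regular modulo it -/

/-- Under `k[a,b,c,d] ≃ k[b,c,d][Y]` (`finSuccEquiv`, `a ↦ Y`), `a² − b³ ↦ Y² − C(b³)`. [plumbing] -/
theorem finSuccEquiv_B (k : Type) [Field k] :
    finSuccEquiv k 3 (X 0 ^ 2 - X 1 ^ 3 : MvPolynomial (Fin 4) k) = Polynomial.X ^ 2 - Polynomial.C ((X 0 : MvPolynomial (Fin 3) k) ^ 3) := by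
  have h1 : finSuccEquiv k 3 (X 1 : MvPolynomial (Fin 4) k) = Polynomial.C (X 0) := by
    have : (1 : Fin 4) = (0 : Fin 3).succ := rfl
    rw [this, finSuccEquiv_X_succ]
  rw [map_sub, map_pow, map_pow, finSuccEquiv_X_zero, h1, ← map_pow]

/-- `b³` is not a square in `k[b,c,d]` (total degree `3` is odd). [elementary] -/
theorem sq_ne_X_pow_three (k : Type) [Field k] (q : MvPolynomial (Fin 3) k) : q ^ 2 ≠ (X 0) ^ 3 := by
  intro h
  have hq : q ≠ 0 := by
    intro hq
    rw [hq, zero_pow two_ne_zero] at h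
    exact (pow_ne_zero 3 (X_ne_zero (0 : Fin 3))) h.symm
  have hdeg := congrArg totalDegree h
  rw [pow_two, totalDegree_mul_of_isDomain hq hq, totalDegree_X_pow] at hdeg
  omega

/-- ★ **THE CUSP `a² − b³` IS PRIME in `k[a,b,c,d]`** (a monic quadratic in `a` over `k[b,c,d]` without a root; `k[X]` is a UFD). [folklore; the `Fin 2` case is in
`Literature.AlgebraicGeometry.Resolution.CuspEmbeddedSequenceCounterexample` (private), same proof] -/
theorem prime_B (k : Type) [Field k] : Prime (X 0 ^ 2 - X 1 ^ 3 : MvPolynomial (Fin 4) k) := by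
  have hmonic : (Polynomial.X ^ 2 - Polynomial.C ((X 0 : MvPolynomial (Fin 3) k) ^ 3)).Monic := Polynomial.monic_X_pow_sub_C _ two_ne_zero
  have hdeg : (Polynomial.X ^ 2 - Polynomial.C ((X 0 : MvPolynomial (Fin 3) k) ^ 3)).natDegree = 2 := Polynomial.natDegree_X_pow_sub_C
  have hirr : Irreducible (Polynomial.X ^ 2 - Polynomial.C ((X 0 : MvPolynomial (Fin 3) k) ^ 3)) := by
    rw [hmonic.irreducible_iff_roots_eq_zero_of_degree_le_three (by omega) (by omega), Multiset.eq_zero_iff_forall_notMem]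
    intro a ha
    rw [Polynomial.mem_roots hmonic.ne_zero, Polynomial.IsRoot, Polynomial.eval_sub, Polynomial.eval_pow, Polynomial.eval_X, Polynomial.eval_C, sub_eq_zero] at ha
    exact sq_ne_X_pow_three k a ha
  rw [← finSuccEquiv_B] at hirr
  exact ((MulEquiv.irreducible_iff (finSuccEquiv k 3).toMulEquiv).mp hirr).prime

/-- `a² − b³ ∤ c` (kill `a` and `b`). [elementary] -/
theorem not_B_dvd_X (k : Type) [Field k] : ¬ (X 0 ^ 2 - X 1 ^ 3 : MvPolynomial (Fin 4) k) ∣ X 2 := by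
  rintro ⟨q, hq⟩
  have h := congrArg (aeval (fun i : Fin 4 => if i = 2 then (X 2 : MvPolynomial (Fin 4) k) else 0)) hq
  rw [map_mul, map_sub, map_pow, map_pow, aeval_X, aeval_X, aeval_X, if_pos rfl, if_neg (by decide : (0 : Fin 4) ≠ 2),
    if_neg (by decide : (1 : Fin 4) ≠ 2)] at h
  norm_num at h

/-- ★ **`c²²` IS REGULAR MODULO `a² − b³`**: `c²²·t ∈ (a² − b³) ⇒ t ∈ (a² − b³)`. [elementary] -/
theorem hreg_U (k : Type) [Field k] (t : MvPolynomial (Fin 4) k)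
    (ht : ((X 2 : MvPolynomial (Fin 4) k) ^ 22) * t ∈ Ideal.span {(X 0 ^ 2 - X 1 ^ 3 : MvPolynomial (Fin 4) k)}) :
    t ∈ Ideal.span {(X 0 ^ 2 - X 1 ^ 3 : MvPolynomial (Fin 4) k)} := by
  rw [Ideal.mem_span_singleton] at ht ⊢
  rcases (prime_B k).dvd_or_dvd ht with h | h
  · exact absurd ((prime_B k).dvd_of_dvd_pow h) (not_B_dvd_X k)
  · exact h

/-- ★ **THE `U`-CHART `{(a² − b³)·U = c²²}` OF `Ω₁`ʼS LOCAL MODEL IS INTEGRAL**: `((a² − b³)·U − c²²)` is a prime ideal of `k[a,b,c,d,U]`. With `isPrime_wChart`: EVERY chart of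
`S′_{Ω₁} = Bl_{(c²², a² − b³)} 𝔸⁴` is integral. [OURS · certificate instance] -/
theorem isPrime_uChart (k : Type) [Field k] (G : MvPolynomial (Fin 5) k)
    (hG : G = rename (Fin.castSucc : Fin 4 → Fin 5) (X 0 ^ 2 - X 1 ^ 3 : MvPolynomial (Fin 4) k) * X (Fin.last 4) -
      rename (Fin.castSucc : Fin 4 → Fin 5) ((X 2 : MvPolynomial (Fin 4) k) ^ 22)) :
    (Ideal.span {G}).IsPrime := by
  rw [hG]
  exact affinePencilChart_isPrime_last k _ _ (B_ne_zero k) (hreg_U k)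

end Summit.ResolutionOfSingularities.ResolutionOfSingularities.Theorems.FInjectiveMacaulayfication.OmegaOneFloorInput

end
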